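import Literature.AnabelianGeometry.EtaleTheta.SettingModelKummerCocycleQ
import Literature.AnabelianGeometry.EtaleTheta.ZHatLevelDetermination
import HarnessLib

/-!
# Continuity of the cyclotome identification `Λ(ℚ̄_p^×) ≅ Ẑ` (proof-only)

[EtTh] §1, Prop. 1.3 / 1.5, PRIMS PDF pp. 21–23 [cite: MochizukiEtTh2009, Prop 1.5 p.23]: the Kummer class lives in
CONTINUOUS cohomology `H¹(…, Δ_Θ)` with `Δ_Θ ≅ Ẑ(1) = Λ(ℚ̄_p^×)`; the coefficient identification must therefore be
continuous (`CyclotomeCoefficients.continuous_hom` of `KummerContH1.lean`, field `continuous_coeffHom` of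
abc-iut-w5-d171's `ThetaSetting.KummerCore`).  PROOF-ONLY file (abc-iut cell, R78 F6 (c) prep, seat abc-iut-w5-d171):

* `ZHatLevel.continuous_of_isLocallyConstant_level` — a map into `Ẑ` all of whose level characters
  `level_n ∘ f : X → ℤ/n` are locally constant is continuous (the pattern of `ZHatLevel.continuous_monoidHom`);
* `cyclotome.isOpen_setOf_apply_eq` — in `Λ(ℚ̄_p^×) ⊆ ∏_n ℚ̄_p^×` the fibres of the `n`-th coordinate are OPEN
  (the coordinate lands in the FINITE set `μ_n`, closed pointwise in the Hausdorff `ℚ̄_p^×`);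
* **`SettingModel.continuous_cycEquiv`** — abc-iut-L2-t5's `cycEquiv p : Λ(ℚ̄_p^×) ≃* Ẑ` (F3c) is continuous, since
  `level_n (e ζ)` is read off `ζ_n` (`level_cycEquiv_eq_iff`).

Classical; nothing of [EtTh] asserted; no side taken on [IUTchIII] Cor. 3.12.
-/

noncomputable section

open CategoryTheory ProfiniteGrp ProfiniteGrp.ProfiniteCompletion Topology

namespace Literature.AnabelianGeometry.EtaleTheta

namespace ZHatLevel

/-- **A map into `Ẑ` with locally constant level characters is continuous.** [cite: RibesZalesskii2010, Thm 2.7.1] -/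
theorem continuous_of_isLocallyConstant_level {X : Type*} [TopologicalSpace X]
    (f : X → completion (GrpCat.of (Multiplicative ℤ)))
    (hf : ∀ n : ℕ+, IsLocallyConstant fun x => level n (f x)) : Continuous f := by
  refine continuous_induced_rng.2 (continuous_pi fun H => ?_)
  haveI : DiscreteTopology ((diagram (GrpCat.of (Multiplicative ℤ))).obj H) := ⟨rfl⟩
  refine continuous_def.2 fun U _ => isOpen_iff_forall_mem_open.2 fun x₀ hx₀ => ?_
  obtain ⟨V, hV, hx₀V, hVeq⟩ := (IsLocallyConstant.iff_exists_open _).1 (hf (indexPNat H)) x₀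
  refine ⟨V, fun x hx => ?_, hV, hx₀V⟩
  have hlev : level (indexPNat H) (f x) = level (indexPNat H) (f x₀) := hVeq x hx
  have hφ : proj (indexPNat H) (f x) = proj (indexPNat H) (f x₀) := proj_eq_iff_level_eq.2 hlev
  have hval : ((f x).val H : Multiplicative ℤ ⧸ H.toSubgroup) = (f x₀).val H := by
    rw [val_eq_map_proj (f x) H, val_eq_map_proj (f x₀) H, hφ]
  show (f x).val H ∈ U
  rw [hval]
  exact hx₀

end ZHatLevel

namespace SettingModel

open Literature.AnabelianGeometry.SemiGraphs (GQp)

variable (p : ℕ) [Fact p.Prime]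

/-- In `Λ(ℚ̄_p^×)` the fibres of the `n`-th coordinate `ζ ↦ ζ_n ∈ μ_n` are open (`μ_n` is finite and `ℚ̄_p^×`
Hausdorff). [cite: MochizukiEtTh2009, Prop 1.3 p.21] -/
theorem cyclotome_isOpen_setOf_apply_eq (n : ℕ+) (u : (PadicAlgCl p)ˣ) :
    IsOpen {ζ : cyclotome (PadicAlgCl p)ˣ | (ζ : ℕ+ → (PadicAlgCl p)ˣ) n = u} := by
  have hπ : Continuous fun ζ : cyclotome (PadicAlgCl p)ˣ => (ζ : ℕ+ → (PadicAlgCl p)ˣ) n :=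
    (continuous_apply n).comp continuous_subtype_val
  have hT : ({v : (PadicAlgCl p)ˣ | v ^ (n : ℕ) = 1 ∧ v ≠ u}).Finite := by
    classical
    have hfin : ((Units.val : (PadicAlgCl p)ˣ → PadicAlgCl p) ⁻¹'
        ((Polynomial.nthRoots (n : ℕ) (1 : PadicAlgCl p)).toFinset : Set (PadicAlgCl p))).Finite :=
      (Finset.finite_toSet _).preimage fun _ _ _ _ h => Units.ext h
    refine hfin.subset fun v hv => ?_
    simp only [Set.mem_preimage, Finset.mem_coe, Multiset.mem_toFinset, Polynomial.mem_nthRoots n.pos]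
    rw [← Units.val_pow_eq_pow_val, hv.1, Units.val_one]
  rw [← isClosed_compl_iff]
  have hc : {ζ : cyclotome (PadicAlgCl p)ˣ | (ζ : ℕ+ → (PadicAlgCl p)ˣ) n = u}ᶜ =
      (fun ζ : cyclotome (PadicAlgCl p)ˣ => (ζ : ℕ+ → (PadicAlgCl p)ˣ) n) ⁻¹'
        {v : (PadicAlgCl p)ˣ | v ^ (n : ℕ) = 1 ∧ v ≠ u} := by
    ext ζ
    simp only [Set.mem_compl_iff, Set.mem_setOf_eq, Set.mem_preimage]
    exact ⟨fun h => ⟨ζ.2.1 n, h⟩, fun h => h.2⟩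
  rw [hc]
  exact hT.isClosed.preimage hπ

/-- **abc-iut-L2-t5's `cycEquiv p : Λ(ℚ̄_p^×) ≃* Ẑ` is continuous**: its level-`n` character is read off the
`n`-th coordinate (`level_cycEquiv_eq_iff`), whose fibres are open. [cite: MochizukiEtTh2009, Prop 1.5 p.23] -/
theorem continuous_cycEquiv : Continuous (cycEquiv p) := by
  refine ZHatLevel.continuous_of_isLocallyConstant_level (X := cyclotome (PadicAlgCl p)ˣ) (cycEquiv p) fun n => ?_
  refine (IsLocallyConstant.iff_exists_open _).2 fun ζ₀ => ?_
  refine ⟨{ζ | (ζ : ℕ+ → (PadicAlgCl p)ˣ) n = (ζ₀ : ℕ+ → (PadicAlgCl p)ˣ) n},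
    cyclotome_isOpen_setOf_apply_eq p n _, rfl, fun ζ hζ => ?_⟩
  have hc : ZHatLevel.level n (cycEquiv p ζ₀) =
      Multiplicative.ofAdd (Multiplicative.toAdd (ZHatLevel.level n (cycEquiv p ζ₀))) := (ofAdd_toAdd _).symm
  rw [hc]
  rw [level_cycEquiv_eq_iff] at hc ⊢
  have hζ' : (ζ : ℕ+ → (PadicAlgCl p)ˣ) n = (ζ₀ : ℕ+ → (PadicAlgCl p)ˣ) n := hζ
  rw [hζ']
  exact hc

end SettingModel

end Literature.AnabelianGeometry.EtaleTheta

end
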